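import Summits.ResolutionOfSingularities.ResolutionOfSingularities.Theorems.HistoryCutCells
import Summits.ResolutionOfSingularities.ResolutionOfSingularities.Theorems.DepthCutCells
import Literature.AlgebraicGeometry.Resolution.BlowupSNC
import Literature.AlgebraicGeometry.Resolution.WeightedInitialTerms
import Mathlib.Algebra.CharP.Lemmas
import HarnessLib

/-!
# WallAlgebra — decomp-res node «WallCut» (lens-4 g30, critic row 176 (pending)), tree file 1/8 of the node

Content VERBATIM from the decomp-res lens-4 g30 node `HOME/decomp-res-lens-4/g30/WallCut.lean` (pin c43ccc48 =
`parts/WallCut-g30-c43ccc48.lean`, 1445 l,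
65 new declarations §81–§86; HOME = run/shared/lean/pub/decomp-res): the node imports the LANDED tree only
(`Theorems/HistoryCutCells` · `MaxContactCutSatelliteCut` ·
`DepthCutCells`, Literature `BlowupSNC`, Mathlib `CharP.Lemmas`) and CARRIES NOTHING (g28 §75–§77 and g29 §78–§80
are the landed `SatelliteTransport…` /
`SatelliteCutCells` / `MaxContactCutSatelliteCut` / `HistoryTransport…` / `HistoryCutCells` /
`MaxContactCutHistoryCut`).  Farm (node): rc 0 · 0 err · 0 warn · 0 sorry ·
axioms {propext, Classical.choice, Quot.sound}; Probe 64d30a68 rc 0 · 23/23 must-fail · 12 axiom guards.  Critic: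
CRITIC-LEDGER row 176 (pending) (window g30 = row 169 axis (F)
FINITENESS IN KERNEL: WALL DEATH — the wall exponent `e` of a two-wall stage drops by exactly one per successor and
its exhaustion is fatal; typed sub-cell
`n = 2 ∧ WalledTower T` of the g29 residual EMPTY for every `n`; EXACT hypothesis-free re-location to
`NoWildWallFreeFreshJumpShallowCompanionKangarooTowers`).
Landing orders INBOX :819 (lens-4 g30 landing note, NEXT-g31 §4): `--kind proof --supports
stmt-ResolutionOfSingularities-28338`, namespace `…Theorems.HugValuationCut`,
canonical headers, D-0064 split: `WallAlgebra` (§81 + §83 `FreeAlgebra`) · `WallTransport` (§82; + `WallTransport2`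
where the 400-line cap cuts) · `WallExit` (§83
`FreeExit`) · `WallTowers` (§84) · `WallCutCells` (§85–§86 minus the four corollaries GIVEN 31571; cone-free cells:
the aside home) · `MaxContactCutWallCut` (the four
corollaries GIVEN 31571 `MaxContactCut.NoContactHuggingTowers` BY NAME — Theses cone, kept apart so that the route
file can import the aside home without an import
cycle; the g29 precedent `MaxContactCutHistoryCut`).  Aside bookkeeping: ONE successor aside on the lens-4 column,
`NoWildWallFreeFreshJumpShallowCompanionKangarooTowers`
(home `WallCutCells`), SUPERSEDING the live g29 aside 27614 `SCNoWildFreshJumpShallowCompanionKangarooTowers`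
(exactness `noWildFreshJumpShallowCompanionKangarooTowers_iff_g30`,
hypothesis-free; the walled cell is PROVED); the decided cell `NoWildWalledTowers` is a THEOREM and is not filed.

The lens header, verbatim:

> # WallCut — decomp-res-lens-4 g30 «WallCut» (lens: minimal counterexample / extremal reduction)
>
> NODE g30 of the lens-4 chain (HugValuationCut g21 → … → AntelopeCut g27 → SatelliteCut g28 → HistoryCut g29 → WallCut g30).
> TARGET = g29's located residual `NoWildFreshJumpShallowCompanionKangarooTowers` (tree `Theorems/HistoryCutCells`): wild ·
> off-locus singular class · `p`-power form at every marked point · weight-`n` kangaroo-recurrent ·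
companion-recurrent · shallow ·
> at prime weight every kangaroo jump FRESH (on none of the components born inside its principal jump-free window).
The critic's
> g30 window (CRITIC-LEDGER row 169): NEXT DECIDED `+1` = (F) a FINITENESS law IN KERNEL — «a monotone quantity …
PROVED to descend»
> or «`FreshStartsTerminate` on a typed sub-class», killing a typed sub-cell of the target with an EXACT
hypothesis-free re-location
> and entrances on BOTH sides, the quantity COMPUTED on the entering profiles and SEEN TO DROP — or (D4); LEMMA J,
freshness laws,
> emptiness theorems, re-rooting, composite weight, statistics are priced 0; the location axis is closed.  Row 169a (ERRATUM):
> NODE-g29's EMPTINESS REMARK is false (below).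
>
> THE LAW OF THIS NODE — «WALL DEATH» (§82–§84, KERNEL, PROVED; weight 2 = characteristic 2, EVERY field of characteristic 2, no
> perfectness, ring dimension 3).  Stage `i` is a TWO-WALL STAGE OF WALL EXPONENT `e ≥ 1` (`TwoWallAt 𝓘 W V H e x_i`, §82) when
> `𝒪_{x_i}` has a FULL regular system `(w, v, z)` with `W = (w)` (the KEPT wall), `V = (v)` (the OTHER wall), `H =
(z)` (the contact
> germ) and some `f ∈ 𝓘_{x_i}` has `f − c·z² = w·v·g`, `c` a unit, with the cofactor in NORMAL FORM `g = u·v^e + a·w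
+ b·z`, `u` AND
> `a` units: the tail is divisible by both walls, of order exactly `e` along `W ∩ H` and exactly `1` along `V ∩ H`.
THEN, for the
> point blow-up `π` of `x_i` and a marked class point `y` over it (`𝓘'_y ⊆ 𝔪_y²`, `𝓘'_y` a `2`-power form):
>  (TICK `twoWall_point_transport`, `dim 𝒪_y ≤ 3`) `y` ON the weak transform `W'` ⟹ `e ≥ 2` AND `TwoWallAt 𝓘' W' E H' (e − 1) y`
>  with the NEW exceptional divisor `E` as the other wall: THE WALL EXPONENT DROPS BY EXACTLY ONE;
>  (EXIT `twoWall_point_exit`, every dimension) `y` OFF `W'` ⟹ `e = 1` AND `y` OFF `V'`;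
>  (FATAL `twoWall_point_fatal`, `dim 𝒪_y ≥ 3`, `X'` regular) `y` OFF `W'` ⟹ ABSURD: the one free direction the exit law leaves
>  open is a point of `E` RATIONAL over `x_i` at which the transported cofactor is itself a regular parameter.
> Along the tower (§84: `twoWall_succ`, `twoWall_run`, `twoWall_exit_succ`, `twoWall_fatal_succ`, `twoWall_noSucc`): A TWO-WALL
> STAGE OF WALL EXPONENT `e` HAS NO `e`-TH SUCCESSOR — the tower makes at most `e − 1` further steps, each a
satellite step along
> the kept wall with the exponent reading `e − 1, …, 1`, and then has NO marked class point to go to.  The wall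
exponent is a PROVED
> STRICTLY DESCENDING POSITIVE INTEGER and its exhaustion is PROVED FATAL: `FreshStartsTerminate`-shape on the typed sub-class
> `WalledTower` (= the tower passes through a two-wall stage; `no_walledTower`).  The law counts no jumps (at `p = 2` a «jump»
> depends on the choice of the contact germ: NODE-g30 §4), uses no re-rooting, no LEMMA J, no location letter, no principality.
>
> MECHANISM (one chart round per statement + the §81/§83 algebra).  TICK: the joint chart round
`point_round_chart_rsop₂` (g29) on
> `(W, H)` gives `π^*w = s·w₁`, `π^*z = s·z'`, `W' = (w₁)`, `H' = (z')`, `(s, w₁, z')` regular letters; `π^*v =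
s·v₁`, and FULLNESS
> `𝔪_x = (w, v, z)` gives `(s) = s·(w₁, v₁, z')`, so `1 ∈ (w₁, v₁, z')` and `v₁` is a UNIT (`w₁, z' ∈ 𝔪_y`);
cancelling `s²`, the
> tail is `w₀ − π^*c·z'² = w₁·s·(v₁g₁)`, `g₁ = π^*u·v₁^e·s^{e−1} + π^*a·w₁ + π^*b·z'` — the normal form at `y` for
the kept wall `w₁`
> and the new other wall `s` with exponent `e − 1` (full system `(w₁, s, z')` by `dim ≤ 3`) — unless `e = 1`, when
`v₁g₁` is a unit
> and `w₀ = π^*c·z'² + s·w₁·unit` is NOT a `2`-power form modulo `𝔪³`: the EXIT LEMMA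
`not_mem_pPowerSpan_of_twoWall_unit` (§81) =
> g28's LEMMA D on the letters `(s, w₁)`.  EXIT: chart round on `(V, H)`; `π^*w = s·w₁` with `w₁` a UNIT (off `W'`); on `V'` the
> EXIT LEMMA on `(s, v₁)` bites (`w₁g₁ ≡ π^*a·w₁²` is a unit); off `V'` with `e ≥ 2`, `g₁ ≡ π^*a·w₁` is a unit and
`w₀ = π^*c·z'² +
> s·unit` has order 1.  FATAL (§83, the new algebra): the EXPLICIT chart round on the full system `c = (w, v, z)`
> (`IsBlowup.exists_reesChart_stalk`, `stalkIdeal_controlledTransform_eq_span_chartGen`): `y` lies in the chart of `w` or of `v`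
> (not of `z`: `z' ∈ 𝔪_y`), `w₁, v₁` are units, `g₁ = π^*u·v₁ + π^*a·w₁ + π^*b·z'`; if `g₁` is a unit the order
drops as before; if
> `g₁ ∈ 𝔪_y` the free chart coordinate is RATIONAL over `x` (`v₁ ≡ −a/u`, resp. `w₁ ≡ −u/a`), so every chart
generator is congruent
> to a constant and `chart_ideal_eq_of_rational` — «for the chart `B = R[𝔪/c_i]` of the blow-up of a local ring at `𝔪 = (c)` and
> an ideal `𝔴 ∌ 1` over `𝔪` with `e_j − λ_j ∈ 𝔴`: `𝔴 = (c_i, e_j − λ_j)_j`», from `eval₂Hom_chartGen_surjective` — gives `𝔪_y =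
> 𝔴·𝒪_y = (s, w₁v₁g₁, z')`; by `dim 𝒪_y ≥ 3` and regularity this is a regular system of parameters
(`isRsopPart_triple_of_span_eq`,
> Krull), and `w₀ = π^*c·z'² + s·(w₁v₁g₁)·1` contradicts the `2`-power form by the EXIT LEMMA once more.
>
> THE CUT (§86): typed sub-cell `WalledTower T` (∃ `i e W V H`: `TwoWallAt (𝓘_i) W V H e x_i` and the next `e` stages of ring
> dimension exactly 3 at their marked points — the letters `DimThreeAt ∧ ¬DimFourAt` of g27, automatic over a threefold base).
> DECIDED cell = g29 residual ∧ (`n = 2` ∧ `WalledTower T`) =: `WildWalledFreshJumpShallowCompanionKangarooTowersTerminate n` —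
> EMPTY for every `n` over every field (`wildWalledFreshJumpShallow_holds`: `p ∣ 2` ⇒ `p = 2`, then
`no_walledTower`); the general
> form `noTowerWild_walled_holds` cuts the weight-2 walled column out of EVERY `p`-power class (lens-6/7/9 residuals alike).
> LOCATED RESIDUAL = g29 residual ∧ ¬(`n = 2` ∧ `WalledTower T`) =:
`WildWallFreeFreshJumpShallowCompanionKangarooTowersTerminate n`,
> by name `NoWildWallFreeFreshJumpShallowCompanionKangarooTowers` ⊆ g29's residual: at weight 2 the tower NEVER
enters the two-wall
> configuration.  EXACT hypothesis-free re-locations: `wildFreshJumpShallow_iff_g30` /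
> `noWildFreshJumpShallowCompanionKangarooTowers_iff_g30` (THE TARGET ⟺ THE RESIDUAL),
> `noWildFreshJumpShallowCompanionKangarooTowers_iff_walled_and_wallFree` (TARGET ⟺ DECIDED ∧ RESIDUAL),
> `noWildFreeJumpShallowCompanionKangarooTowers_iff_g30`, `noWildShallowCompanionKangarooTowers_iff_g30`,
> `noWildCompanionKangarooTowers_iff_g30`, and GIVEN 31571 (`h71`) the aside chain down to the tree aside 28338
> (`noWildContactFreeOffLocusTowers_iff_g30`, through the LANDED g28 wiring `Theorems/MaxContactCutSatelliteCut`).  The weaker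
> off-clock cells of the exit law alone (`WallRunTower`, `WallExitTower`, `OffClockTower`; `no_offClockTower`, every ring
> dimension) are kept in §84 as corollaries.
>
> INHABITANTS (§85: kernel-checked chart identities; isolation of the marked points by hand from the partials; ring dimension 3,
> characteristic 2).  DECIDED side — the configuration occurs, THE EXPONENT IS COMPUTED, SEEN TO DROP, AND THE
PROFILE THEN HAS NO
> CLASS SUCCESSOR: (E1) census chain (HOME/census/it/history, T-history f608fd95 (i)) «2:E8iso:y2+x3+u5:FOFF0:1»,
word `u x u u`:
> `y² + x³ + u⁵ →(u) y² + x³u + u³ →(x) y² + x·u·(x + u²)` [TWO-WALL: `W = E₂ = (x)`, `V = E₁' = (u)`, `g = 1·u² +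
1·x`, `e = 2`]
> `→(u) y² + x·u·(x + u)` [on `W'`: `e = 1`, the TICK]; its candidate successors: on `W''` the `u`-chart origin `y²
+ x·u·(x + 1)`
> (cofactor a unit, `in₂ = y² + xu` not a square: EXIT), in the `x`-chart `y² + x·t·(1 + t)`, `t = u/x`
(`entrance_E8iso_chart₄_free`):
> `t = 0` is on `V'' = E₃'` (lateral: EXIT), `t = 1` is THE RATIONAL FREE POINT where the cofactor `1 + t` vanishes
and `(x, 1+t, y)`
> is a regular system with `in₂ = y² + x(1+t)·unit` not a square (FATAL), elsewhere the order is `≤ 1` — NO class successor; the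
> census records exit «CONTACT» at exactly this node, and of the 42 characteristic-2 `l = 1` windows of T-history
(i) ALL 42 exit by
> CONTACT, 0 by JUMP (row 169a): wall death's signature.  (E2) hand chain `z² + x³ + u⁴ + u⁵ / 𝔽₂` (`x₀` isolated: `∂_x = x²`,
> `∂_u = u⁴`) `→(u) z² + u² + x³u + u³ = (z + u)² + u·(x³ + u²)`: a FRESH kangaroo jump at `x₁ ∈ E₁` only (isolated:
`∂_x = x²u`,
> `∂_u = x³ + u²`) `→(x) (z+u)'² + x²u + xu³` = the two-wall stage of (E1) (`e = 2`): WALLED, hence dead two stages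
later — a fresh
> jump does not save a tower from the wall; g28's decided chain `z² + u³ + v⁵ → … → z''² + u'v''(u' + v''²)` (`e = 2`) likewise.
> RESIDUAL side: (R1) at `p ≥ 3` the whole g29 residual (NODE-g29's characteristic-5 fresh-jump chain `z⁵ + x⁴(y³ −
x²)² + x⁷y²`,
> four fresh jumps, shade 2) is untouched by the weight-2 law and carries every positive letter; (R2) at `p = 2` NO wall-free
> fresh-jumping profile is known: every characteristic-2 profile computed so far (both hand chains, the 42 census windows, g28's
> chain) is walled within two blow-ups of each jump — the cell may well be EMPTY at `p = 2`, which is the ENTRY LAW of NEXT-g31.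
>
> ERRATUM to NODE-g29 (CRITIC-LEDGER row 169a): its EMPTINESS REMARK («for `p ≤ 3` no weight-`p` tower makes two consecutive
> satellite steps after a principal stage; the `l ≥ 1` configurations start at `p = 5`») is FALSE — census T-history
(i): the `l = 1`
> sub-word occurs 82× at `p ≤ 3` ((2,2): 42, (3,3): 40; exits at `x_{b+3}`: CONTACT 62, SHAPE 20, JUMP 0; witnesses
(3,3) `y³ + xy²u +
> x⁴u² + u⁵ / 𝔽₃`, (2,2) `y² + x³ + u⁵ + xu³ / 𝔽₂`).  Nothing of the remark was typed and nothing here uses it; the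
E8iso chain above
> IS such a window, and wall death is the law that explains its CONTACT exit.
>
> DELIMITERS: (i) WEIGHT 2 = CHARACTERISTIC 2 (the normal form with the two unit letters `u`, `a` is typed for
`z²`-tails; at `p ≥
> 3` nothing is claimed); (ii) TICK needs ring dimension ≤ 3 and FATAL ring dimension ≥ 3 at the successor — the
cell carries the
> letters `DimThreeAt ∧ ¬DimFourAt` (g27's), EXIT holds in every dimension; lens-6's infinite all-satellite cube tower
> (`SatelliteExitKernels.satelliteRecurs_*`: `p = 3`, ring dimension 4, NON-isolated points) meets neither
hypothesis; (iii) the law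
> starts AT a two-wall stage — the ENTRY LAW (why the satellite point after a fresh jump, or after any stage with an
`E`-divisible
> tail, is a two-wall stage: in all hand and census profiles the jump letter `λ·s²` makes the cofactor linear in the
new wall) is
> NEXT-g31; with it every weight-2 fresh-jumping tower over a threefold dies; (iv) no composite weight, no `p ≥ 3`, no MAP.
>
> NEW part = §81–§86 (65 declarations): 0 sorry · axioms ⊆ {propext, Classical.choice, Quot.sound} · no `instance` ·
no `notation` ·
> imports the TREE only — g28 §75–§77 and g29 §78–§80 have LANDED
(`Theorems/SatelliteTransport|SatelliteTransport2|SatelliteCutCells|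
> MaxContactCutSatelliteCut|HistoryTransport|HistoryTransport2|HistoryCutCells`, 2026-08-31T02:11–03:04Z): NOTHING is carried.

## This file

§81 (NEW, KERNEL) WALL ALGEBRA — `section WallAlgebra`: full regular triples in ring dimension `< 4`, units, and THE
EXIT LEMMA (pure commutative algebra); and the ALGEBRA HALF of §83 — `section FreeAlgebra` (universe `u`): the free
exit point's chart algebra (pure commutative algebra).  The scheme-level §82 (`WallTransport`), §83 `FreeExit`
(`WallExit`), §84 (`WallTowers`) and the cells §85–§86 (`WallCutCells`, cone-free aside home;
`MaxContactCutWallCut`, the corollaries GIVEN 31571 in the Theses cone) follow in import order.  Imports exactly the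
node's tree imports minus `MaxContactCutSatelliteCut` (needed only by the Theses-cone corollaries).  (This first
part carries: `span_range_eq_maximalIdeal_of_rsopTriple`, `span_triple_eq_maximalIdeal`,
`isUnit_of_one_mem_span_triple`, `not_mem_pPowerSpan_of_twoWall_unit`, `isRsopPart_triple_swap`, `eval₂Hom_chartGen_sub_mem`.)

[WRITER NOTE (decomp-res writer g11): file split only (tree files ≤ 400 lines); namespace, universes, sections,
section variables and every declaration
exactly as in the lens (the node's global dupNamespace-linter line is dropped — the library sets it; the `open
…Theses` line lives only in the Theses-cone file;
`set_option maxHeartbeats … in` prefixes of single declarations are kept VERBATIM).  ONE deletion (gate dedup rule,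
critic :835 watch-list): the node's private copy of
isUnit_add_of_mem_maximalIdeal` is NOT re-landed — it is LITERALLY the landed
`Literature.AlgebraicGeometry.Resolution.isUnit_add_of_mem_maximalIdeal` (`WeightedInitialTerms`,
imported; the namespace is opened as in the lens), which the transport proofs now cite by the same short name.]

(Sources: Hauser2010Kangaroo (arXiv:0811.4151, Kangaroo Theorem condition (3)); HauserPerlega2019 §2; Hauser2024
PRIMS 60; Moh1987; Perlega2023; Matsumura1987 Thms. 14.2–14.3, 19.x; ZariskiSamuel1960 VIII §11; StacksProject Tags
0804, 0BIQ, 00NQ, 0AGS; DeJong1996 2.4; CossartPiltant2008 §2; Giraud1975.)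
-/

noncomputable section

open CategoryTheory AlgebraicGeometry IsLocalRing
open Literature.AlgebraicGeometry.Resolution
open Summit.ResolutionOfSingularities.ResolutionOfSingularities.Theorems
open WeakOrderReduction ForcedTowerClasses DivergentTowerClasses MonomialTowerClasses
open HugDimensionClasses HugDimensionKernels SurfaceShadowClasses SurfaceShadowKernels
open NearPointCut (SingularClass)
open scoped BigOperators

namespace Summit.ResolutionOfSingularities.ResolutionOfSingularities.Theorems.HugValuationCut

section WallAlgebra

variable {R : Type*} [CommRing R]

/-! ## §81 (g30 · NEW · KERNEL) WALL ALGEBRA: full regular triples in ring dimension `< 4`, units, and THE EXIT LEMMA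
`c·z^p + s·w·(unit) ∉ (p-th powers of 𝔪) + 𝔪^{p+1}` for two regular-system letters `(s, w)` (from LEMMA D, g28). -/

/-- in ring dimension `< 4` a regular TRIPLE is a FULL regular system of parameters. [folklore] -/
theorem span_range_eq_maximalIdeal_of_rsopTriple [IsLocalRing R] {x : Fin 3 → R} (h : IsRsopPart x)
    (hdim : ¬ (4 : WithBot ℕ∞) ≤ ringKrullDim R) : Ideal.span (Set.range x) = maximalIdeal R := by
  obtain ⟨-, e, y, hd, hs⟩ := h
  have he : e = 0 := by
    by_contra hne
    apply hdim
    rw [hd]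
    have h4 : (4 : ℕ) ≤ 3 + e := by omega
    have h4' : ((4 : ℕ) : WithBot ℕ∞) ≤ ((3 + e : ℕ) : WithBot ℕ∞) := by exact_mod_cast h4
    simpa using h4'
  subst he
  have hr : Set.range y = ∅ := Set.range_eq_empty _
  rw [hr, Set.union_empty] at hs
  exact hs

/-- the set form: `span {a, b, c} = 𝔪` for a regular triple in ring dimension `< 4`. [folklore] -/
theorem span_triple_eq_maximalIdeal [IsLocalRing R] {a b c : R} (h : IsRsopPart ![a, b, c])
    (hdim : ¬ (4 : WithBot ℕ∞) ≤ ringKrullDim R) : Ideal.span {a, b, c} = maximalIdeal R := by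
  have h1 := span_range_eq_maximalIdeal_of_rsopTriple h hdim
  have hr : Set.range ![a, b, c] = {a, b, c} := by
    ext r
    simp only [Set.mem_range, Set.mem_insert_iff, Set.mem_singleton_iff]
    constructor
    · rintro ⟨i, rfl⟩
      fin_cases i <;> simp
    · rintro (rfl | rfl | rfl)
      exacts [⟨0, rfl⟩, ⟨1, rfl⟩, ⟨2, rfl⟩]
  rwa [hr] at h1

/-- `1 ∈ (a, b, c)` with `a, c ∈ 𝔪` forces `b` to be a unit. [folklore] -/
theorem isUnit_of_one_mem_span_triple [IsLocalRing R] {a b c : R} (h1 : (1 : R) ∈ Ideal.span {a, b, c})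
    (ha : a ∈ maximalIdeal R) (hc : c ∈ maximalIdeal R) : IsUnit b := by
  by_contra hb
  have hbm : b ∈ maximalIdeal R := (IsLocalRing.mem_maximalIdeal _).mpr (mem_nonunits_iff.mpr hb)
  have hle : Ideal.span {a, b, c} ≤ maximalIdeal R := by
    rw [Ideal.span_le]
    rintro r (rfl | rfl | rfl)
    exacts [ha, hbm, hc]
  exact (maximalIdeal.isMaximal R).ne_top ((Ideal.eq_top_iff_one _).mpr (hle h1))

/-- **THE EXIT LEMMA (LEMMA D applied).** In characteristic `p`, with `(s, w)` part of a regular system, `z ∈ 𝔪` and `g` a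
UNIT, the element `c·z^p + s·w·g` is NOT of `p`-power form modulo `𝔪^{p+1}`: its tail `s·w·g` is divisible by two
independent letters and has order exactly `2 < p + 1`. (Sources: Hauser2010Kangaroo; Matsumura1987, Thm. 14.2.) -/
theorem not_mem_pPowerSpan_of_twoWall_unit (p : ℕ) [Fact p.Prime] [CharP R p] [IsLocalRing R] {s w g c z : R}
    (h : IsRsopPart ![s, w]) (hg : IsUnit g) (hz : z ∈ maximalIdeal R) :
    c * z ^ p + s * w * g ∉
      Ideal.span ((fun h => h ^ p) '' ↑(maximalIdeal R ^ (p / p))) ⊔ maximalIdeal R ^ (p + 1) := by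
  haveI := h.isRegularLocalRing
  have hp : p.Prime := Fact.out
  have hpp : p / p = 1 := Nat.div_self hp.pos
  rw [hpp, pow_one]
  intro hmem
  have hS : (↑(maximalIdeal R) : Set R) ⊆ maximalIdeal R := le_rfl
  have hzp : c * z ^ p ∈ Ideal.span ((fun h => h ^ p) '' ↑(maximalIdeal R)) :=
    Ideal.mul_mem_left _ _ (Ideal.subset_span ⟨z, hz, rfl⟩)
  have h1 : s * w * g ∈ Ideal.span ((fun h => h ^ p) '' ↑(maximalIdeal R)) ⊔ maximalIdeal R ^ (p + 1) := by
    have := sub_mem hmem (Ideal.mem_sup_left hzp)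
    rwa [add_sub_cancel_left] at this
  have h2 : s * w * g ∈ maximalIdeal R ^ (p + 1) :=
    mem_pow_succ_of_rsopPair_pPowerSpan p h hS rfl h1
  have h3 : g * (s * w) ∈ maximalIdeal R ^ (p + 1) := by rw [mul_comm]; exact h2
  have h4 : s * w ∈ maximalIdeal R ^ (p + 1) := (Ideal.unit_mul_mem_iff_mem _ hg).mp h3
  have h5 : s * w ∈ maximalIdeal R ^ 3 := Ideal.pow_le_pow_right (by have := hp.two_le; omega) h4
  have h6 := h.prod_not_mem_pow_succ
  simp only [Fin.prod_univ_two, Matrix.cons_val_zero, Matrix.cons_val_one] at h6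
  exact h6 h5

/-- swapping the first two letters of a regular triple. [folklore] -/
theorem isRsopPart_triple_swap [IsLocalRing R] {a b c : R} (h : IsRsopPart ![a, b, c]) : IsRsopPart ![b, a, c] :=
  isRsopPart_of_range_eq h rfl (by
    ext r
    simp only [Set.mem_range]
    constructor
    · rintro ⟨i, rfl⟩
      fin_cases i
      exacts [⟨1, rfl⟩, ⟨0, rfl⟩, ⟨2, rfl⟩]
    · rintro ⟨i, rfl⟩
      fin_cases i
      exacts [⟨1, rfl⟩, ⟨0, rfl⟩, ⟨2, rfl⟩])

end WallAlgebra

section FreeAlgebra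

universe u
variable {R : Type u} [CommRing R] {n : ℕ} (c : Fin n → R) (i : Fin n)

/-! ## §83 (g30 · NEW · KERNEL) THE FREE EXIT POINT IS FATAL: at a point of the exceptional divisor whose chart coordinates
are RATIONAL over the centre (`e_j ≡ λ_j`), the maximal ideal is `(c_i, e_j − λ_j)` (`chart_ideal_eq_of_rational`);
at the one free
direction left open by the exit law the transported cofactor itself is the third regular parameter, and the EXIT
LEMMA bites again
(`twoWall_point_fatal`, ring dimension 3). -/

/-- evaluation at the chart generators differs from evaluation at constants `λ` by an element of any ideal containing the
differences `e_j − λ_j`. [folklore] -/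
theorem eval₂Hom_chartGen_sub_mem (lam : {j : Fin n // j ≠ i} → R) (Q : Ideal (chartRing c i))
    (hQ : ∀ j, chartGen c i j.1 - chartBase c i (lam j) ∈ Q) (p : MvPolynomial {j : Fin n // j ≠ i} R) :
    MvPolynomial.eval₂Hom (chartBase c i) (fun j => chartGen c i j.1) p -
      chartBase c i (MvPolynomial.eval lam p) ∈ Q := by
  induction p using MvPolynomial.induction_on with
  | C a =>
    have e1 : MvPolynomial.eval₂Hom (chartBase c i) (fun j : {j : Fin n // j ≠ i} => chartGen c i j.1)
          (MvPolynomial.C a) = chartBase c i (MvPolynomial.eval lam (MvPolynomial.C a)) := by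
      rw [MvPolynomial.eval₂Hom_C, MvPolynomial.eval_C]
    have e2 : chartBase c i (MvPolynomial.eval lam (MvPolynomial.C a)) -
        chartBase c i (MvPolynomial.eval lam (MvPolynomial.C a)) = (0 : chartRing c i) := by ring
    rw [e1, e2]
    exact Q.zero_mem
  | add p q hp hq =>
    have e1 : MvPolynomial.eval₂Hom (chartBase c i) (fun j => chartGen c i j.1) (p + q) -
        chartBase c i (MvPolynomial.eval lam (p + q)) =
        (MvPolynomial.eval₂Hom (chartBase c i) (fun j => chartGen c i j.1) p - chartBase c i (MvPolynomial.eval lam p)) +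
        (MvPolynomial.eval₂Hom (chartBase c i) (fun j => chartGen c i j.1) q -
          chartBase c i (MvPolynomial.eval lam q)) := by
      rw [map_add, map_add, map_add]; ring
    rw [e1]
    exact Q.add_mem hp hq
  | mul_X p j hp =>
    have e1 : MvPolynomial.eval₂Hom (chartBase c i) (fun j => chartGen c i j.1) (p * MvPolynomial.X j) -
        chartBase c i (MvPolynomial.eval lam (p * MvPolynomial.X j)) =
        (MvPolynomial.eval₂Hom (chartBase c i) (fun j => chartGen c i j.1) p - chartBase c i (MvPolynomial.eval lam p)) *
          chartGen c i j.1 +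
        chartBase c i (MvPolynomial.eval lam p) * (chartGen c i j.1 - chartBase c i (lam j)) := by
      rw [map_mul, map_mul, map_mul, MvPolynomial.eval₂Hom_X', MvPolynomial.eval_X]; ring
    rw [e1]
    exact Q.add_mem (Q.mul_mem_right _ hp) (Q.mul_mem_left _ (hQ j))

end FreeAlgebra

end Summit.ResolutionOfSingularities.ResolutionOfSingularities.Theorems.HugValuationCut
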